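import Summits.BirchSwinnertonDyer.Rank1Residual.Iwasawa.LambdaInvariantZeroSet
import Mathlib.RingTheory.Polynomial.Cyclotomic.Eval
import HarnessLib

/-!
# The `p`-adic absolute value of `G(z)` for `G ∈ Λ ∖ {0}`: `|G(z)| = p^{-μ(G)} |z|^{λ(G)}` as soon
# as `|z|^{λ(G)} > 1/p`; the valuation of `G(ζ − 1)` at `p`-power roots of unity and the
# ONE-VALUE CERTIFICATE `|G(ζ − 1)| > 1/p ⟹ μ(G) = 0 ∧ λ(G) = φ(pⁿ⁺¹)·v_p(G(ζ − 1))`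
# (cell `b2b-bsdres`; class-agnostic kernel support for the (μ, λ) censuses of iw-1 / iw-2 and for
# iw-2's ENGINE T; prover unit `b2b-bsdres-additive-p3`, gen 10; part 1/4)

HONEST FRAMING (run/shared/lean/b2b/bsd-rank1-residual/, verbatim in every file): the goal of the
cell is to DELETE the COMBINATION-SHAPED residual classes of the Birch–Swinnerton-Dyer formula for
ALL analytic-rank `≤ 1` elliptic curves over `ℚ` — "full BSD formula for every rank `≤ 1` curve in
class `C`" assembled STRICTLY from published theorems — so that the rank-`≤ 1` remainder becomes
exactly the CONSTRUCTION-SHAPED classes, which are TYPED (missing-input `Prop`s), NOT attempted.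
This is not "finishing BSD". THEOREMS ONLY (pure `p`-adic algebra); no definition, no named fact;
nothing about any curve is asserted; nothing booked; no label changes.

## What this file proves

Gens 6–9 of this unit turned ONE Iwasawa-invariant certificate `(μ, λ)` into statements about the
ZEROS of `G ∈ Λ = ℤ_p⟦T⟧` at the points `ζ − 1` (vanishing / non-vanishing of twisted `L`-values,
zero counting). The present file proves the finer classical statement behind all of them — the
EXACT absolute value of `G` on the open unit disc of `ℂ_p` off a small neighbourhood of `0`
(Washington, GTM 83, §7.1–7.2; the computation every `(μ, λ)` engine of the cell performs):

* §1 for a distinguished polynomial `P ∈ ℤ_p[X]` of degree `d` and `|z| ≤ 1`: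
  `|P(z)| ≤ max(|z|^d, 1/p)`, with `|P(z)| = |z|^d` as soon as `|z|^d > 1/p`
  (`norm_eval₂_le_max_of_isDistinguishedAt`, `norm_eval₂_eq_of_isDistinguishedAt`);
* §2 a unit `U ∈ Λˣ` has `|U(z)| = 1` for `|z| < 1` (`norm_tsum_eq_one_of_isUnit`);
* §3 **THE VALUATION THEOREM**: for `G ∈ Λ ∖ {0}` and `|z| < 1`,
  `|G(z)| ≤ p^{−μ(G)} · max(|z|^{λ(G)}, 1/p)` always, and **`|G(z)| = p^{−μ(G)} · |z|^{λ(G)}` whenever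
  `|z|^{λ(G)} > 1/p`** (`norm_tsum_le_of_ne_zero`, `norm_tsum_eq_of_lt_norm_pow_lam`; Weierstrass
  preparation `G = p^μ · P · U`); conversely **`|G(z)| > 1/p` forces `μ(G) = 0`, `|z|^{λ(G)} > 1/p`
  and `|G(z)| = |z|^{λ(G)}`** (`mu_eq_zero_of_lt_norm_tsum`), while `|G(z)| ≤ 1/p` forces
  `μ(G) ≥ 1 ∨ |z|^{λ(G)} ≤ 1/p` (`one_le_mu_or_pow_lam_le_of_norm_tsum_le`);
* §4–§5 (roots of unity `|ζ − 1|^{φ(pⁿ⁺¹)} = 1/p`; the layer form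
  `v_p(G(ζ − 1)) = μ(G) + λ(G)/φ(pⁿ⁺¹)` and the ONE-VALUE CERTIFICATE
  `|G(ζ − 1)| > 1/p ⟹ μ(G) = 0 ∧ λ(G) = φ(pⁿ⁺¹)·v_p(G(ζ − 1))` — the validity rule of iw-2's
  ENGINE T and MU-CERTIFICATES as a kernel theorem) are part 2,
  `Iwasawa/LambdaInvariantValuationLayer.lean`; the arithmetic instances (Birch sums = twisted special
  values of `p`-adic `L`-functions and of Mazur–Tate elements; Sprung's `L♯/L♭` on class X8) follow in
  `Iwasawa/LambdaInvariantValuationTwisted.lean` and `Supersingular/MazurTateValuation.lean`.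

References (ATTRIBUTION of classical statements; the proofs here are self-contained over Mathlib's
Weierstrass preparation): [Washington1997] §7.1–7.2 (Prop. 7.2, Thm. 7.3); [Lang1990] Ch. 5 §2
Thm. 2.2 (PDF p. 97: `f = (Xⁿ + b_{n−1}Xⁿ⁻¹ + ⋯ + b₀)·u`, `b_i ∈ 𝔪`, `u` a unit); [Pollack2003]
Prop. 6.9–6.10 (the model computation `λ(θ_n)` ↔ `ord_p` of twisted values);
HOME/b2b-bsdres-additive-p3/X8-ROUTE-B.md §15 (gen 10).
-/

set_option autoImplicit false

noncomputable section

open scoped Classical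

open Polynomial Literature.NumberTheory.EllipticCurves
  Summit.BirchSwinnertonDyer.Rank1Residual.X1.MuLambda

namespace Summit.BirchSwinnertonDyer.Rank1Residual.Iwasawa

variable {p : ℕ} [hp : Fact p.Prime]

/-! ## §0. Small normed-field facts in `ℂ_p` -/

section Basic

/-- `‖ιℂ(p^m)‖ = p^{-m}` for the structure map `ιℂ : ℤ_p → ℂ_p`. [folklore] -/
theorem norm_algebraMap_comp_natCast_pow (m : ℕ) :
    ‖((algebraMap ℚ_[p] ℂ_[p]).comp (algebraMap ℤ_[p] ℚ_[p])) ((p : ℤ_[p]) ^ m)‖ =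
      ((p : ℝ)⁻¹) ^ m := by
  rw [norm_algebraMap_comp_apply, norm_pow, PadicInt.norm_p]

/-- `0 < 1/p < 1`. [folklore] -/
theorem inv_prime_pos_and_lt_one : 0 < ((p : ℝ)⁻¹) ∧ ((p : ℝ)⁻¹) < 1 := by
  have hp1 : (1 : ℝ) < p := by exact_mod_cast hp.out.one_lt
  exact ⟨inv_pos.mpr (lt_trans one_pos hp1), inv_lt_one_of_one_lt₀ hp1⟩

/-- An element of the maximal ideal of `ℤ_p` has `‖ιℂ a‖ ≤ 1/p`. [folklore] -/
theorem norm_algebraMap_comp_le_inv_of_mem_maximalIdeal {a : ℤ_[p]}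
    (ha : a ∈ IsLocalRing.maximalIdeal ℤ_[p]) :
    ‖((algebraMap ℚ_[p] ℂ_[p]).comp (algebraMap ℤ_[p] ℚ_[p])) a‖ ≤ (p : ℝ)⁻¹ := by
  rw [PadicInt.maximalIdeal_eq_span_p, Ideal.mem_span_singleton] at ha
  obtain ⟨b, rfl⟩ := ha
  rw [norm_algebraMap_comp_apply, norm_mul, PadicInt.norm_p]
  exact mul_le_of_le_one_right (inv_nonneg.mpr (Nat.cast_nonneg _)) (PadicInt.norm_le_one b)

/-- A root of unity in `ℂ_p` has absolute value `1`. [folklore] -/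
theorem norm_eq_one_of_pow_eq_one_padicComplex {ζ : ℂ_[p]} {k : ℕ} (hk : k ≠ 0) (h : ζ ^ k = 1) :
    ‖ζ‖ = 1 := by
  have h1 : ‖ζ‖ ^ k = 1 := by rw [← norm_pow, h, norm_one]
  exact (pow_eq_one_iff_of_nonneg (norm_nonneg ζ) hk).mp h1

end Basic

/-! ## §1. Distinguished polynomials: `|P(z)| = |z|^{deg P}` off a small disc -/

section Distinguished

/-- **Upper bound.** For a distinguished polynomial `P ∈ ℤ_p[X]` of degree `d` (monic, lower
coefficients in `pℤ_p`) and `|z| ≤ 1` in `ℂ_p`: `|P(z)| ≤ max(|z|^d, 1/p)` — every lower term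
`a_i z^i` has `|a_i z^i| ≤ 1/p`. [cite: Washington1997, §7.1 (distinguished polynomials) and Prop. 7.2] -/
theorem norm_eval₂_le_max_of_isDistinguishedAt {P : ℤ_[p][X]}
    (hP : P.IsDistinguishedAt (IsLocalRing.maximalIdeal ℤ_[p])) {z : ℂ_[p]} (hz : ‖z‖ ≤ 1) :
    ‖P.eval₂ ((algebraMap ℚ_[p] ℂ_[p]).comp (algebraMap ℤ_[p] ℚ_[p])) z‖ ≤
      max (‖z‖ ^ P.natDegree) ((p : ℝ)⁻¹) := by
  set ιZ : ℤ_[p] →+* ℂ_[p] := (algebraMap ℚ_[p] ℂ_[p]).comp (algebraMap ℤ_[p] ℚ_[p]) with hιZ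
  set d := P.natDegree with hd
  have hmonic : P.Monic := hP.monic
  -- `P(z) = (Σ_{i<d} a_i z^i) + z^d`
  have hsplit : P.eval₂ ιZ z = (∑ i ∈ Finset.range d, ιZ (P.coeff i) * z ^ i) + z ^ d := by
    rw [eval₂_eq_sum_range, Finset.sum_range_succ, ← hd]
    congr 1
    rw [show P.coeff d = 1 from hmonic.coeff_natDegree ▸ (by rw [hd]), map_one, one_mul]
  -- every lower term is `≤ 1/p`
  have hterm : ∀ i ∈ Finset.range d, ‖ιZ (P.coeff i) * z ^ i‖ ≤ (p : ℝ)⁻¹ := by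
    intro i hi
    rw [Finset.mem_range] at hi
    have hmem : P.coeff i ∈ IsLocalRing.maximalIdeal ℤ_[p] := hP.mem (by rw [← hd]; exact hi)
    rw [norm_mul, norm_pow]
    calc ‖ιZ (P.coeff i)‖ * ‖z‖ ^ i ≤ (p : ℝ)⁻¹ * 1 :=
          mul_le_mul (norm_algebraMap_comp_le_inv_of_mem_maximalIdeal hmem)
            (pow_le_one₀ (norm_nonneg _) hz) (pow_nonneg (norm_nonneg _) _)
            (inv_nonneg.mpr (Nat.cast_nonneg _))
      _ = (p : ℝ)⁻¹ := mul_one _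
  have hlow : ‖∑ i ∈ Finset.range d, ιZ (P.coeff i) * z ^ i‖ ≤ (p : ℝ)⁻¹ :=
    IsUltrametricDist.norm_sum_le_of_forall_le_of_nonneg (inv_nonneg.mpr (Nat.cast_nonneg _)) hterm
  rw [hsplit]
  calc ‖(∑ i ∈ Finset.range d, ιZ (P.coeff i) * z ^ i) + z ^ d‖
      ≤ max ‖∑ i ∈ Finset.range d, ιZ (P.coeff i) * z ^ i‖ ‖z ^ d‖ :=
        IsUltrametricDist.norm_add_le_max _ _
    _ ≤ max ((p : ℝ)⁻¹) (‖z‖ ^ d) := max_le_max hlow (by rw [norm_pow])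
    _ = max (‖z‖ ^ d) ((p : ℝ)⁻¹) := max_comm _ _

/-- **Exact value.** For a distinguished `P ∈ ℤ_p[X]` of degree `d`, `|z| ≤ 1` and
`|z|^d > 1/p`: `|P(z)| = |z|^d` (the lower terms are `≤ 1/p < |z^d|`; ultrametric equality).
[cite: Washington1997, §7.1 (distinguished polynomials) and Prop. 7.2] -/
theorem norm_eval₂_eq_of_isDistinguishedAt {P : ℤ_[p][X]}
    (hP : P.IsDistinguishedAt (IsLocalRing.maximalIdeal ℤ_[p])) {z : ℂ_[p]} (hz : ‖z‖ ≤ 1)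
    (hlt : (p : ℝ)⁻¹ < ‖z‖ ^ P.natDegree) :
    ‖P.eval₂ ((algebraMap ℚ_[p] ℂ_[p]).comp (algebraMap ℤ_[p] ℚ_[p])) z‖ = ‖z‖ ^ P.natDegree := by
  set ιZ : ℤ_[p] →+* ℂ_[p] := (algebraMap ℚ_[p] ℂ_[p]).comp (algebraMap ℤ_[p] ℚ_[p]) with hιZ
  set d := P.natDegree with hd
  have hmonic : P.Monic := hP.monic
  have hsplit : P.eval₂ ιZ z = (∑ i ∈ Finset.range d, ιZ (P.coeff i) * z ^ i) + z ^ d := by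
    rw [eval₂_eq_sum_range, Finset.sum_range_succ, ← hd]
    congr 1
    rw [show P.coeff d = 1 from hmonic.coeff_natDegree ▸ (by rw [hd]), map_one, one_mul]
  have hterm : ∀ i ∈ Finset.range d, ‖ιZ (P.coeff i) * z ^ i‖ ≤ (p : ℝ)⁻¹ := by
    intro i hi
    rw [Finset.mem_range] at hi
    have hmem : P.coeff i ∈ IsLocalRing.maximalIdeal ℤ_[p] := hP.mem (by rw [← hd]; exact hi)
    rw [norm_mul, norm_pow]
    calc ‖ιZ (P.coeff i)‖ * ‖z‖ ^ i ≤ (p : ℝ)⁻¹ * 1 :=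
          mul_le_mul (norm_algebraMap_comp_le_inv_of_mem_maximalIdeal hmem)
            (pow_le_one₀ (norm_nonneg _) hz) (pow_nonneg (norm_nonneg _) _)
            (inv_nonneg.mpr (Nat.cast_nonneg _))
      _ = (p : ℝ)⁻¹ := mul_one _
  have hlow : ‖∑ i ∈ Finset.range d, ιZ (P.coeff i) * z ^ i‖ < ‖z ^ d‖ := by
    rw [norm_pow]
    exact lt_of_le_of_lt
      (IsUltrametricDist.norm_sum_le_of_forall_le_of_nonneg (inv_nonneg.mpr (Nat.cast_nonneg _)) hterm)
      hlt
  rw [hsplit, IsUltrametricDist.norm_add_eq_max_of_norm_ne_norm hlow.ne, max_eq_right hlow.le,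
    norm_pow]

end Distinguished

/-! ## §2. Units of `Λ` have absolute value `1` on the open unit disc -/

section Units

/-- `|A(z)| ≤ 1` for every `A ∈ Λ` and `|z| < 1` (all terms have absolute value `≤ 1`). [folklore] -/
theorem norm_tsum_le_one (A : IwasawaAlgebra p) {z : ℂ_[p]} (hz : ‖z‖ < 1) :
    ‖∑' k, ((algebraMap ℚ_[p] ℂ_[p]).comp (algebraMap ℤ_[p] ℚ_[p])) (PowerSeries.coeff k A) *
      z ^ k‖ ≤ 1 := by
  refine IsUltrametricDist.norm_tsum_le_of_forall_le_of_nonneg zero_le_one fun k ↦ ?_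
  rw [norm_mul, norm_pow]
  exact mul_le_one₀ (norm_algebraMap_coeff_le_one A k) (pow_nonneg (norm_nonneg _) _)
    (pow_le_one₀ (norm_nonneg _) hz.le)

/-- **A unit of `Λ` has `|U(z)| = 1` for `|z| < 1`**: `|U(z)| ≤ 1`, `|U⁻¹(z)| ≤ 1` and
`U(z)·U⁻¹(z) = 1` (evaluation is multiplicative on the open disc). [cite: Washington1997, §7.1] -/
theorem norm_tsum_eq_one_of_isUnit {U : IwasawaAlgebra p} (hU : IsUnit U) {z : ℂ_[p]}
    (hz : ‖z‖ < 1) :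
    ‖∑' k, ((algebraMap ℚ_[p] ℂ_[p]).comp (algebraMap ℤ_[p] ℚ_[p])) (PowerSeries.coeff k U) *
      z ^ k‖ = 1 := by
  set ιZ : ℤ_[p] →+* ℂ_[p] := (algebraMap ℚ_[p] ℂ_[p]).comp (algebraMap ℤ_[p] ℚ_[p]) with hιZ
  have hbd : ∀ (A : PowerSeries ℤ_[p]) (k : ℕ), ‖ιZ (PowerSeries.coeff k A)‖ ≤ 1 :=
    norm_algebraMap_coeff_le_one
  obtain ⟨V, hUV⟩ := hU.exists_right_inv
  have hUV' : (∑' k, ιZ (PowerSeries.coeff k U) * z ^ k) *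
      ∑' k, ιZ (PowerSeries.coeff k V) * z ^ k = 1 := by
    rw [← tsum_map_coeff_mul_mul_pow ιZ (hbd _) (hbd _) hz, hUV,
      (hasSum_map_coeff_one_mul_pow ιZ z).tsum_eq]
  have hn : ‖∑' k, ιZ (PowerSeries.coeff k U) * z ^ k‖ *
      ‖∑' k, ιZ (PowerSeries.coeff k V) * z ^ k‖ = 1 := by rw [← norm_mul, hUV', norm_one]
  have hU1 := norm_tsum_le_one U hz
  have hV1 := norm_tsum_le_one V hz
  by_contra hne
  have hlt : ‖∑' k, ιZ (PowerSeries.coeff k U) * z ^ k‖ < 1 := lt_of_le_of_ne hU1 hne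
  have : ‖∑' k, ιZ (PowerSeries.coeff k U) * z ^ k‖ *
      ‖∑' k, ιZ (PowerSeries.coeff k V) * z ^ k‖ < 1 := by
    calc _ ≤ ‖∑' k, ιZ (PowerSeries.coeff k U) * z ^ k‖ * 1 :=
          mul_le_mul_of_nonneg_left hV1 (norm_nonneg _)
      _ < 1 := by rw [mul_one]; exact hlt
  exact absurd hn this.ne

end Units

/-! ## §3. The valuation theorem: `|G(z)| = p^{-μ(G)} |z|^{λ(G)}` -/

section Valuation

/-- **Evaluation factorises through `G = p^m · P · U`** (`p`-content, Weierstrass preparation):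
for `|z| < 1`, `G(z) = ιℂ(p^m) · P(z) · U(z)`. [cite: Washington1997, §7.1–7.2 and Thm. 7.3] -/
theorem tsum_eq_mul_eval₂_mul_tsum {G G' : IwasawaAlgebra p} {m : ℕ}
    (hGG' : G = PowerSeries.C ((p : ℤ_[p]) ^ m) * G')
    (hG' : G'.map (IsLocalRing.residue ℤ_[p]) ≠ 0) {z : ℂ_[p]} (hz : ‖z‖ < 1) :
    ∑' k, ((algebraMap ℚ_[p] ℂ_[p]).comp (algebraMap ℤ_[p] ℚ_[p])) (PowerSeries.coeff k G) * z ^ k =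
      ((algebraMap ℚ_[p] ℂ_[p]).comp (algebraMap ℤ_[p] ℚ_[p])) ((p : ℤ_[p]) ^ m) *
        ((G'.weierstrassDistinguished hG').eval₂
            ((algebraMap ℚ_[p] ℂ_[p]).comp (algebraMap ℤ_[p] ℚ_[p])) z *
          ∑' k, ((algebraMap ℚ_[p] ℂ_[p]).comp (algebraMap ℤ_[p] ℚ_[p]))
            (PowerSeries.coeff k (G'.weierstrassUnit hG')) * z ^ k) := by
  set ιZ : ℤ_[p] →+* ℂ_[p] := (algebraMap ℚ_[p] ℂ_[p]).comp (algebraMap ℤ_[p] ℚ_[p]) with hιZ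
  have hbd : ∀ (A : PowerSeries ℤ_[p]) (k : ℕ), ‖ιZ (PowerSeries.coeff k A)‖ ≤ 1 :=
    norm_algebraMap_coeff_le_one
  have hfac : G' = ((G'.weierstrassDistinguished hG' : ℤ_[p][X]) : PowerSeries ℤ_[p]) *
      G'.weierstrassUnit hG' :=
    G'.eq_weierstrassDistinguished_mul_weierstrassUnit hG'
  rw [hGG', tsum_map_coeff_mul_mul_pow ιZ (hbd _) (hbd _) hz,
    (hasSum_map_coeff_C_mul_pow ιZ _ z).tsum_eq]
  conv_lhs => rw [hfac]
  rw [tsum_map_coeff_mul_mul_pow ιZ (hbd _) (hbd _) hz,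
    (hasSum_map_coeff_coe_mul_pow ιZ (G'.weierstrassDistinguished hG') z).tsum_eq]

/-- **`|G(z)| = p^{-μ(G)} · |P(z)|`** with `P` the distinguished polynomial of the `p`-free part
(`|U(z)| = 1`), `deg P = λ(G)`. [cite: Washington1997, §7.1–7.2 and Thm. 7.3] -/
theorem norm_tsum_eq_mul_norm_eval₂ {G G' : IwasawaAlgebra p} {m : ℕ}
    (hGG' : G = PowerSeries.C ((p : ℤ_[p]) ^ m) * G')
    (hG' : G'.map (IsLocalRing.residue ℤ_[p]) ≠ 0) {z : ℂ_[p]} (hz : ‖z‖ < 1) :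
    ‖∑' k, ((algebraMap ℚ_[p] ℂ_[p]).comp (algebraMap ℤ_[p] ℚ_[p])) (PowerSeries.coeff k G) *
        z ^ k‖ =
      ((p : ℝ)⁻¹) ^ mu G * ‖(G'.weierstrassDistinguished hG').eval₂
        ((algebraMap ℚ_[p] ℂ_[p]).comp (algebraMap ℤ_[p] ℚ_[p])) z‖ := by
  have hμ : mu G = m := (mu_eq_and_pfree_eq (g := G) hG' hGG').1
  rw [tsum_eq_mul_eval₂_mul_tsum hGG' hG' hz, norm_mul, norm_mul,
    norm_tsum_eq_one_of_isUnit (G'.isUnit_weierstrassUnit hG') hz, mul_one,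
    norm_algebraMap_comp_natCast_pow, hμ]

/-- **Upper bound, always**: for `G ∈ Λ ∖ {0}` and `|z| < 1`,
`|G(z)| ≤ p^{-μ(G)} · max(|z|^{λ(G)}, 1/p)`. [cite: Washington1997, §7.1–7.2 and Thm. 7.3] -/
theorem norm_tsum_le_of_ne_zero {G : IwasawaAlgebra p} (hG0 : G ≠ 0) {z : ℂ_[p]} (hz : ‖z‖ < 1) :
    ‖∑' k, ((algebraMap ℚ_[p] ℂ_[p]).comp (algebraMap ℤ_[p] ℚ_[p])) (PowerSeries.coeff k G) *
        z ^ k‖ ≤ ((p : ℝ)⁻¹) ^ mu G * max (‖z‖ ^ lam G) ((p : ℝ)⁻¹) := by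
  obtain ⟨m, G', hGG', hG'⟩ := IwasawaAlgebra.exists_eq_C_pow_mul_and_map_residue_ne_zero p hG0
  rw [norm_tsum_eq_mul_norm_eval₂ hGG' hG' hz, lam_eq_natDegree_weierstrassDistinguished hGG' hG']
  exact mul_le_mul_of_nonneg_left
    (norm_eval₂_le_max_of_isDistinguishedAt (G'.isDistinguishedAt_weierstrassDistinguished hG') hz.le)
    (pow_nonneg (inv_nonneg.mpr (Nat.cast_nonneg _)) _)

/-- **THE VALUATION THEOREM.** For `G ∈ Λ ∖ {0}` and `|z| < 1` with `|z|^{λ(G)} > 1/p`: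
**`|G(z)| = p^{-μ(G)} · |z|^{λ(G)}`**, i.e. `v_p(G(z)) = μ(G) + λ(G)·v_p(z)` whenever
`λ(G)·v_p(z) < 1`. [cite: Washington1997, §7.1–7.2 and Thm. 7.3] [cite: Lang1990, Ch. 5 §2 Thm. 2.2 (PDF p. 97)] -/
theorem norm_tsum_eq_of_lt_norm_pow_lam {G : IwasawaAlgebra p} (hG0 : G ≠ 0) {z : ℂ_[p]}
    (hz : ‖z‖ < 1) (hlt : (p : ℝ)⁻¹ < ‖z‖ ^ lam G) :
    ‖∑' k, ((algebraMap ℚ_[p] ℂ_[p]).comp (algebraMap ℤ_[p] ℚ_[p])) (PowerSeries.coeff k G) *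
        z ^ k‖ = ((p : ℝ)⁻¹) ^ mu G * ‖z‖ ^ lam G := by
  obtain ⟨m, G', hGG', hG'⟩ := IwasawaAlgebra.exists_eq_C_pow_mul_and_map_residue_ne_zero p hG0
  rw [lam_eq_natDegree_weierstrassDistinguished hGG' hG'] at hlt ⊢
  rw [norm_tsum_eq_mul_norm_eval₂ hGG' hG' hz,
    norm_eval₂_eq_of_isDistinguishedAt (G'.isDistinguishedAt_weierstrassDistinguished hG') hz.le hlt]

/-- **THE ONE-VALUE CERTIFICATE.** For `G ∈ Λ ∖ {0}` and `|z| < 1`: if **`|G(z)| > 1/p`** then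
`μ(G) = 0`, `|z|^{λ(G)} > 1/p` and `|G(z)| = |z|^{λ(G)}` — so ONE value determines `μ = 0` and
`λ(G) = v_p(G(z))/v_p(z)`. [cite: Washington1997, §7.1–7.2 and Thm. 7.3] -/
theorem mu_eq_zero_of_lt_norm_tsum {G : IwasawaAlgebra p} (hG0 : G ≠ 0) {z : ℂ_[p]}
    (hz : ‖z‖ < 1)
    (h : (p : ℝ)⁻¹ < ‖∑' k, ((algebraMap ℚ_[p] ℂ_[p]).comp (algebraMap ℤ_[p] ℚ_[p]))
      (PowerSeries.coeff k G) * z ^ k‖) :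
    mu G = 0 ∧ (p : ℝ)⁻¹ < ‖z‖ ^ lam G ∧
      ‖∑' k, ((algebraMap ℚ_[p] ℂ_[p]).comp (algebraMap ℤ_[p] ℚ_[p])) (PowerSeries.coeff k G) *
        z ^ k‖ = ‖z‖ ^ lam G := by
  obtain ⟨hq0, hq1⟩ := inv_prime_pos_and_lt_one (p := p)
  have hle := norm_tsum_le_of_ne_zero hG0 hz
  have hmax1 : max (‖z‖ ^ lam G) ((p : ℝ)⁻¹) ≤ 1 :=
    max_le (pow_le_one₀ (norm_nonneg _) hz.le) hq1.le
  -- `μ(G) = 0`: otherwise `|G(z)| ≤ (1/p)·1`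
  have hμ : mu G = 0 := by
    by_contra hne
    have h1 : ((p : ℝ)⁻¹) ^ mu G ≤ (p : ℝ)⁻¹ := by
      calc ((p : ℝ)⁻¹) ^ mu G ≤ ((p : ℝ)⁻¹) ^ 1 :=
            pow_le_pow_of_le_one hq0.le hq1.le (Nat.one_le_iff_ne_zero.mpr hne)
        _ = (p : ℝ)⁻¹ := pow_one _
    have h2 : ((p : ℝ)⁻¹) ^ mu G * max (‖z‖ ^ lam G) ((p : ℝ)⁻¹) ≤ (p : ℝ)⁻¹ :=
      le_trans (mul_le_mul h1 hmax1 (le_trans hq0.le (le_max_right _ _)) hq0.le) (by rw [mul_one])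
    exact absurd (lt_of_lt_of_le h (le_trans hle h2)) (lt_irrefl _)
  rw [hμ, pow_zero, one_mul] at hle
  -- `|z|^λ > 1/p`: otherwise `|G(z)| ≤ 1/p`
  have hlt : (p : ℝ)⁻¹ < ‖z‖ ^ lam G := by
    by_contra hge
    rw [not_lt] at hge
    rw [max_eq_right hge] at hle
    exact absurd (lt_of_lt_of_le h hle) (lt_irrefl _)
  refine ⟨hμ, hlt, ?_⟩
  rw [norm_tsum_eq_of_lt_norm_pow_lam hG0 hz hlt, hμ, pow_zero, one_mul]

/-- **The complementary regime**: `|G(z)| ≤ 1/p` forces `μ(G) ≥ 1` or `|z|^{λ(G)} ≤ 1/p`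
(contrapositive of the valuation theorem at `μ = 0`). [cite: Washington1997, §7.1–7.2 and Thm. 7.3] -/
theorem one_le_mu_or_pow_lam_le_of_norm_tsum_le {G : IwasawaAlgebra p} (hG0 : G ≠ 0) {z : ℂ_[p]}
    (hz : ‖z‖ < 1)
    (h : ‖∑' k, ((algebraMap ℚ_[p] ℂ_[p]).comp (algebraMap ℤ_[p] ℚ_[p]))
      (PowerSeries.coeff k G) * z ^ k‖ ≤ (p : ℝ)⁻¹) :
    1 ≤ mu G ∨ ‖z‖ ^ lam G ≤ (p : ℝ)⁻¹ := by
  by_contra hcon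
  rw [not_or, not_le, not_le, Nat.lt_one_iff] at hcon
  obtain ⟨hμ, hlt⟩ := hcon
  have heq := norm_tsum_eq_of_lt_norm_pow_lam hG0 hz hlt
  rw [hμ, pow_zero, one_mul] at heq
  rw [heq] at h
  exact absurd (lt_of_lt_of_le hlt h) (lt_irrefl _)

/-- Conversely `μ(G) ≥ 1` or `|z|^{λ(G)} ≤ 1/p` forces `|G(z)| ≤ 1/p`. [cite: Washington1997, §7.1–7.2 and Thm. 7.3] -/
theorem norm_tsum_le_of_one_le_mu_or_pow_lam_le {G : IwasawaAlgebra p} (hG0 : G ≠ 0) {z : ℂ_[p]}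
    (hz : ‖z‖ < 1) (h : 1 ≤ mu G ∨ ‖z‖ ^ lam G ≤ (p : ℝ)⁻¹) :
    ‖∑' k, ((algebraMap ℚ_[p] ℂ_[p]).comp (algebraMap ℤ_[p] ℚ_[p]))
      (PowerSeries.coeff k G) * z ^ k‖ ≤ (p : ℝ)⁻¹ := by
  by_contra hcon
  rw [not_le] at hcon
  obtain ⟨hμ, hlt, -⟩ := mu_eq_zero_of_lt_norm_tsum hG0 hz hcon
  rcases h with h1 | h2
  · rw [hμ] at h1
    exact Nat.not_succ_le_zero 0 h1
  · exact absurd (lt_of_lt_of_le hlt h2) (lt_irrefl _)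

end Valuation

end Summit.BirchSwinnertonDyer.Rank1Residual.Iwasawa

end
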